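import Literature.NumberTheory.Sieve.SmoothRestrictionParams
import Literature.NumberTheory.Sieve.LargeSieveInequality
import HarnessLib

/-!
# Restriction for smooth numbers, II: the discrete `L^{5/2}` restriction estimate

Topic `Literature/NumberTheory/Sieve`; a PROVED file toward
`Literature.NumberTheory.DiophantineGeometry.XYZUpperHalf` ([Harper2016, Cor. 1]). A discrete
form of Theorem 2 of op. cit. with `p = 5/2`, at the points `k/N₀` (`0 ≤ k < N₀ ≤ x`): for
`|a_n| ≤ 1`,

`discreteRestriction_five_halves`:
`∑_{k < N₀} |∑_{n ≤ x, n ∈ S(y)} a_n e(nk/N₀)|^{5/2} ≤ C (log x)¹⁹ 𝓟^{5/2}`, `𝓟 = x^α ζ(α,y)/√φ₂(α,y)`,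

valid once `1 − α(x,y) ≤ 10⁻⁴` and `Ψ(x,y) ≥ x^{1−1/40000}` (both hold for `y ≥ (log x)^{C}`,
see `le_saddlePoint_of_polylog` and `card_smoothNumbersUpTo_polylog_ge`). Proof as in op. cit.,
§4 (deduction of Theorem 2 from (4.1), p. 18): dyadic level sets `|S| ∈ (𝓟C₂2^{−j−1}, 𝓟C₂2^{−j}]`
are counted by `largeValues_count_le` (the points `k/N₀` are `1/x`-spaced) down to the level
`≍ (log x) x^{−1/20000}`, below which the `L²` bound `∑_k |S(k/N₀)|² ≤ 4xΨ(x,y)` (the large sieve,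
`LargeSieve.largeSieve_wellSpaced`) suffices.

## References

* A. J. Harper, *Minor arcs, mean values, and restriction theory for exponential sums over smooth
  numbers*, Compositio Math. 152 (2016) 1121–1158, Theorem 2 and §4, p. 18 [Harper2016].
-/

noncomputable section

open Finset Real
open scoped FourierTransform

namespace Literature.NumberTheory.Sieve

/-! ### The `L²` bound at the points `k/N₀` -/

/-- **Discrete mean square** (large sieve at the points `k/N₀`, `N₀ ≤ x`): for `S ⊆ [1, x]` and
`|a_n| ≤ 1`, `∑_{k<N₀} |∑_{n ∈ S} a_n e(nk/N₀)|² ≤ 4x · #S`.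
[cite: Huxley1972, Ch. 7, (7.8)] -/
theorem sum_norm_sq_points_le {x : ℝ} {N₀ : ℕ} (hN₀ : 1 ≤ N₀) (hNx : (N₀ : ℝ) ≤ x)
    (S : Finset ℕ) (hS : ∀ n ∈ S, 1 ≤ n ∧ n ≤ ⌊x⌋₊) (a : ℕ → ℂ) (ha : ∀ n, ‖a n‖ ≤ 1) :
    ∑ k ∈ Finset.range N₀, ‖∑ n ∈ S, a n * (𝐞 ((n : ℝ) * ((k : ℝ) / N₀)) : ℂ)‖ ^ 2 ≤
      4 * x * S.card := by
  classical
  have hN₀r : (0 : ℝ) < N₀ := by exact_mod_cast hN₀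
  have hx1 : 1 ≤ x := le_trans (by exact_mod_cast hN₀) hNx
  -- separation of the points `k/N₀`
  have hsep : ∀ r ∈ Finset.range N₀, ∀ s ∈ Finset.range N₀, r ≠ s → ∀ k : ℤ,
      1 / (N₀ : ℝ) ≤ |(s : ℝ) / N₀ - (r : ℝ) / N₀ - k| := by
    intro r hr s hs hrs k
    rw [Finset.mem_range] at hr hs
    have hm : ((s : ℤ) - r - k * N₀ : ℤ) ≠ 0 := by
      intro h
      have hdvd : (N₀ : ℤ) ∣ (s : ℤ) - r := ⟨k, by linarith⟩
      have hlt : |(s : ℤ) - r| < N₀ := by rw [abs_lt]; constructor <;> omega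
      have := Int.eq_zero_of_abs_lt_dvd hdvd hlt
      omega
    have h1 : (1 : ℝ) ≤ |(((s : ℤ) - r - k * N₀ : ℤ) : ℝ)| := by exact_mod_cast Int.one_le_abs hm
    have heq : (s : ℝ) / N₀ - (r : ℝ) / N₀ - k = (((s : ℤ) - r - k * N₀ : ℤ) : ℝ) / N₀ := by
      push_cast; field_simp
    rw [heq, abs_div, abs_of_pos hN₀r]
    exact div_le_div_of_nonneg_right h1 hN₀r.le
  -- the coefficients on `ℤ`
  set S' : Finset ℤ := S.map Nat.castEmbedding with hS'
  set a' : ℤ → ℂ := fun m => if m ∈ S' then a m.toNat else 0 with ha'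
  set N : ℕ := ⌊x⌋₊ with hN
  have hsub : S' ⊆ Finset.Ioc (0 : ℤ) (0 + N) := by
    intro m hm
    rw [hS', Finset.mem_map] at hm
    obtain ⟨n, hn, rfl⟩ := hm
    obtain ⟨h1, h2⟩ := hS n hn
    simp only [Nat.castEmbedding_apply, Finset.mem_Ioc]
    constructor <;> omega
  have hLS := LargeSieve.largeSieve_wellSpaced (Finset.range N₀) (fun k : ℕ => (k : ℝ) / N₀)
    (δ := 1 / N₀) (by positivity) hsep a' 0 N
  -- reindex the inner sums
  have hinner : ∀ t : ℝ, ∑ m ∈ Finset.Ioc (0 : ℤ) (0 + N), a' m * LargeSieve.e (m * t) =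
      ∑ n ∈ S, a n * (𝐞 ((n : ℝ) * t) : ℂ) := by
    intro t
    rw [← Finset.sum_subset hsub (fun m _ hm => by simp [ha', hm])]
    rw [hS', Finset.sum_map]
    refine Finset.sum_congr rfl fun n hn => ?_
    have hmem : (Nat.castEmbedding n : ℤ) ∈ S.map Nat.castEmbedding := Finset.mem_map_of_mem _ hn
    simp only [ha', hS'] at hmem ⊢
    rw [if_pos hmem]
    simp [Nat.castEmbedding_apply, LargeSieve.e]
  have hcoef : ∑ m ∈ Finset.Ioc (0 : ℤ) (0 + N), ‖a' m‖ ^ 2 ≤ S.card := by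
    rw [← Finset.sum_subset hsub (fun m _ hm => by simp [ha', hm])]
    rw [hS', Finset.sum_map]
    calc ∑ n ∈ S, ‖a' (Nat.castEmbedding n)‖ ^ 2 ≤ ∑ n ∈ S, (1 : ℝ) := by
          refine Finset.sum_le_sum fun n hn => ?_
          have hmem : (Nat.castEmbedding n : ℤ) ∈ S.map Nat.castEmbedding := Finset.mem_map_of_mem _ hn
          simp only [ha', hS'] at hmem ⊢
          rw [if_pos hmem]
          simp only [Nat.castEmbedding_apply, Int.toNat_natCast]
          have := ha n
          nlinarith [norm_nonneg (a n)]
      _ = S.card := by simp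
  simp only [hinner] at hLS
  refine hLS.trans ?_
  have hNx : (N : ℝ) ≤ x := Nat.floor_le (by linarith)
  have hconst : (N : ℝ) + 1 + 2 / (1 / (N₀ : ℝ)) ≤ 4 * x := by
    rw [one_div, div_inv_eq_mul]; linarith
  calc ((N : ℝ) + 1 + 2 / (1 / (N₀ : ℝ))) * ∑ m ∈ Finset.Ioc (0 : ℤ) (0 + N), ‖a' m‖ ^ 2
      ≤ (4 * x) * S.card :=
        mul_le_mul hconst hcoef (Finset.sum_nonneg fun _ _ => by positivity) (by positivity)
    _ = 4 * x * S.card := by ring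

/-! ### Dyadic levels -/

/-- **Dyadic levels**: for `0 ≤ F ≤ B` and `J ∈ ℕ`,
`F^p ≤ ∑_{j<J} (B/2^j)^p [B/2^{j+1} < F] + [F ≤ B/2^J] F^p`. [folklore] -/
theorem rpow_le_levels {F B p : ℝ} (hF0 : 0 ≤ F) (hFB : F ≤ B) (hp : 0 ≤ p) (J : ℕ) :
    F ^ p ≤ ∑ j ∈ Finset.range J, (B / 2 ^ j) ^ p * (if B / 2 ^ (j + 1) < F then 1 else 0) +
      (if F ≤ B / 2 ^ J then F ^ p else 0) := by
  classical
  have hB0 : 0 ≤ B := hF0.trans hFB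
  have hterm0 : ∀ j, 0 ≤ (B / 2 ^ j) ^ p * (if B / 2 ^ (j + 1) < F then (1 : ℝ) else 0) := by
    intro j; split_ifs <;> positivity
  by_cases hlast : F ≤ B / 2 ^ J
  · rw [if_pos hlast]
    have : 0 ≤ ∑ j ∈ Finset.range J, (B / 2 ^ j) ^ p * (if B / 2 ^ (j + 1) < F then (1 : ℝ) else 0) :=
      Finset.sum_nonneg fun j _ => hterm0 j
    linarith
  · rw [if_neg hlast, add_zero]
    push Not at hlast
    -- `J ≥ 1`, and the level `j₀ = min {j : B/2^{j+1} < F} < J`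
    have hex : ∃ j, B / 2 ^ (j + 1) < F := by
      rcases Nat.eq_zero_or_pos J with h0 | hpos
      · rw [h0, pow_zero, div_one] at hlast; linarith
      · refine ⟨J - 1, ?_⟩; rwa [Nat.sub_add_cancel hpos]
    set j₀ := Nat.find hex with hj₀
    have hj₀spec : B / 2 ^ (j₀ + 1) < F := Nat.find_spec hex
    have hj₀J : j₀ < J := by
      rcases Nat.eq_zero_or_pos J with h0 | hpos
      · rw [h0, pow_zero, div_one] at hlast; linarith
      · have : B / 2 ^ (J - 1 + 1) < F := by rwa [Nat.sub_add_cancel hpos]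
        have := Nat.find_min' hex this
        omega
    have hFle : F ≤ B / 2 ^ j₀ := by
      rcases Nat.eq_zero_or_pos j₀ with h0 | hpos
      · rw [h0, pow_zero, div_one]; exact hFB
      · have hmin := Nat.find_min hex (show j₀ - 1 < j₀ by omega)
        rw [Nat.sub_add_cancel hpos] at hmin
        exact not_lt.mp hmin
    calc F ^ p ≤ (B / 2 ^ j₀) ^ p := Real.rpow_le_rpow hF0 hFle hp
      _ = (B / 2 ^ j₀) ^ p * (if B / 2 ^ (j₀ + 1) < F then 1 else 0) := by rw [if_pos hj₀spec, mul_one]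
      _ ≤ ∑ j ∈ Finset.range J, (B / 2 ^ j) ^ p * (if B / 2 ^ (j + 1) < F then 1 else 0) :=
          Finset.single_le_sum (f := fun j => (B / 2 ^ j) ^ p * (if B / 2 ^ (j + 1) < F then (1 : ℝ) else 0))
            (fun j _ => hterm0 j) (Finset.mem_range.mpr hj₀J)

/-- Summing `rpow_le_levels` over a finite family. [folklore] -/
theorem sum_rpow_le_levels {κ : Type*} (I : Finset κ) (F : κ → ℝ) {B p : ℝ} (hF0 : ∀ k ∈ I, 0 ≤ F k)
    (hFB : ∀ k ∈ I, F k ≤ B) (hp : 0 ≤ p) (J : ℕ) :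
    ∑ k ∈ I, F k ^ p ≤
      ∑ j ∈ Finset.range J, (B / 2 ^ j) ^ p * ((I.filter (fun k => B / 2 ^ (j + 1) < F k)).card : ℝ) +
        ∑ k ∈ I.filter (fun k => F k ≤ B / 2 ^ J), F k ^ p := by
  classical
  calc ∑ k ∈ I, F k ^ p
      ≤ ∑ k ∈ I, (∑ j ∈ Finset.range J, (B / 2 ^ j) ^ p * (if B / 2 ^ (j + 1) < F k then 1 else 0) +
          (if F k ≤ B / 2 ^ J then F k ^ p else 0)) :=
        Finset.sum_le_sum fun k hk => rpow_le_levels (hF0 k hk) (hFB k hk) hp J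
    _ = _ := by
        rw [Finset.sum_add_distrib, Finset.sum_comm, Finset.sum_filter]
        congr 1
        refine Finset.sum_congr rfl fun j _ => ?_
        rw [← Finset.mul_sum, Finset.card_eq_sum_ones, Finset.sum_filter]
        push_cast
        rfl

/-! ### Geometric sums -/

/-- `∑_{j<J} (2^{-5/2})^j ≤ 2` and `∑_{j<J} (2^{-1/20})^j ≤ 40`. [folklore] -/
theorem geom_sums_aux (J : ℕ) :
    ∑ j ∈ Finset.range J, ((2 : ℝ) ^ (-((5 : ℝ) / 2))) ^ j ≤ 2 ∧
      ∑ j ∈ Finset.range J, ((2 : ℝ) ^ (-((1 : ℝ) / 20))) ^ j ≤ 40 := by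
  have key : ∀ {r : ℝ} {b : ℝ}, 0 ≤ r → r ≤ 1 - 1 / b → 0 < b →
      ∑ j ∈ Finset.range J, r ^ j ≤ b := by
    intro r b hr hrb hb
    have hr1 : r < 1 := lt_of_le_of_lt hrb (by
      have : 0 < 1 / b := by positivity
      linarith)
    have h := geom_sum_Ico_le_of_lt_one (m := 0) (n := J) hr hr1
    rw [← Finset.range_eq_Ico, pow_zero] at h
    refine h.trans ?_
    rw [div_le_iff₀ (by linarith)]
    have : 1 / b * b = 1 := by field_simp
    nlinarith
  constructor
  · refine key (by positivity) ?_ (by norm_num)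
    calc (2 : ℝ) ^ (-((5 : ℝ) / 2)) ≤ 2 ^ (-(1 : ℝ)) := Real.rpow_le_rpow_of_exponent_le (by norm_num) (by norm_num)
      _ = 1 - 1 / 2 := by rw [Real.rpow_neg_one]; norm_num
  · refine key (by positivity) ?_ (by norm_num)
    -- `2^{-1/20} ≤ 39/40` iff `40/39 ≤ 2^{1/20}` iff `(40/39)^20 ≤ 2`
    have h1 : ((40 : ℝ) / 39) ≤ 2 ^ ((1 : ℝ) / 20) := by
      have h2 : (((40 : ℝ) / 39) ^ (20 : ℕ)) ^ ((1 : ℝ) / 20) ≤ (2 : ℝ) ^ ((1 : ℝ) / 20) :=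
        Real.rpow_le_rpow (by positivity) (by norm_num) (by norm_num)
      rwa [← Real.rpow_natCast, ← Real.rpow_mul (by norm_num), show ((20 : ℕ) : ℝ) * (1 / 20) = 1 by norm_num,
        Real.rpow_one] at h2
    have h3 : (2 : ℝ) ^ (-((1 : ℝ) / 20)) = 1 / 2 ^ ((1 : ℝ) / 20) := by
      rw [Real.rpow_neg (by norm_num), inv_eq_one_div]
    rw [h3, div_le_iff₀ (by positivity)]
    nlinarith

/-! ### The restriction estimate -/

set_option maxHeartbeats 8000000 in
-- a long assembly
/-- **Discrete `L^{5/2}` restriction for smooth numbers** (Harper, Theorem 2, discrete form with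
`p = 5/2`). See the module docstring. [cite: Harper2016, Theorem 2 and §4, p. 18] -/
theorem discreteRestriction_five_halves :
    ∃ C x₀ : ℝ, 0 < C ∧ ∀ (x : ℝ) (y : ℕ), x₀ ≤ x → Real.log x ^ 8 ≤ y →
      Real.log y ≤ 1 / 2 * Real.log x ^ (1 / 6 : ℝ) → (y : ℝ) ^ 200 ≤ x →
      1 - 1 / 10000 ≤ saddlePoint x y →
      x ^ ((39999 : ℝ) / 40000) ≤ ((Nat.smoothNumbersUpTo ⌊x⌋₊ (y + 1)).card : ℝ) →
      ∀ (N₀ : ℕ), 1 ≤ N₀ → (N₀ : ℝ) ≤ x → ∀ (a : ℕ → ℂ), (∀ n, ‖a n‖ ≤ 1) →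
        ∑ k ∈ Finset.range N₀,
            ‖∑ n ∈ Nat.smoothNumbersUpTo ⌊x⌋₊ (y + 1), a n * (𝐞 ((n : ℝ) * ((k : ℝ) / N₀)) : ℂ)‖ ^
              ((5 : ℝ) / 2) ≤
          C * Real.log x ^ (19 : ℕ) * (x ^ saddlePoint x y *
            (smoothZeta (saddlePoint x y) y / Real.sqrt (saddlePhi₂ (saddlePoint x y) y))) ^ ((5 : ℝ) / 2) := by
  classical
  obtain ⟨C_A, x₀A, hC_A, hA⟩ := largeValues_count_le
  obtain ⟨C₂0, x₀M, hC₂0, hM⟩ := card_smoothNumbersUpTo_le_model_of_le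
  set C₂ : ℝ := max C₂0 1 with hC₂def
  have hC₂1 : 1 ≤ C₂ := le_max_right _ _
  have hC₂ge : C₂0 ≤ C₂ := le_max_left _ _
  have hC₂0' : 0 < C₂ := by linarith
  refine ⟨322 * C_A * C₂ ^ ((5 : ℝ) / 2) + 6 * C₂ ^ 2, max (max x₀A x₀M) (Real.exp (6400000000 + 26 * C₂)),
    by positivity, fun x y hx hy8 hy6 hy200 hα hΨ N₀ hN₀ hNx a ha => ?_⟩
  have hx₀A : x₀A ≤ x := le_trans ((le_max_left _ _).trans (le_max_left _ _)) hx
  have hx₀M : x₀M ≤ x := le_trans ((le_max_right _ _).trans (le_max_left _ _)) hx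
  have hxe : Real.exp (6400000000 + 26 * C₂) ≤ x := le_trans (le_max_right _ _) hx
  ------------------------------------------------------------------
  -- ### the range
  set L₀ := Real.log x with hL₀
  have hLge : 6400000000 + 26 * C₂ ≤ L₀ := by
    have := Real.log_le_log (Real.exp_pos _) hxe; rwa [Real.log_exp] at this
  have hL64 : 6400000000 ≤ L₀ := by linarith
  have hx1 : 1 < x := by
    have : (1 : ℝ) < Real.exp (6400000000 + 26 * C₂) := by
      have := Real.add_one_le_exp (6400000000 + 26 * C₂); linarith
    exact lt_of_lt_of_le this hxe
  have hx0 : 0 < x := by linarith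
  have hL2 : 2 ≤ L₀ := by linarith
  have hL1 : 1 ≤ L₀ := by linarith
  have hL0 : 0 < L₀ := by linarith
  have hN₀r : (0 : ℝ) < N₀ := by exact_mod_cast hN₀
  have hy4 : Real.log x ^ 4 ≤ y := le_trans (pow_le_pow_right₀ hL1 (by norm_num)) hy8
  have hyL : L₀ ^ 2 ≤ y := le_trans (pow_le_pow_right₀ hL1 (by norm_num)) hy8
  have hy1 : (1 : ℝ) ≤ y := by nlinarith
  have hy0 : (0 : ℝ) < y := by linarith
  have hy2 : 2 ≤ y := by exact_mod_cast (show (2 : ℝ) ≤ y by nlinarith)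
  have hy6' : Real.log y ≤ Real.log x ^ (1 / 6 : ℝ) := by
    refine hy6.trans ?_
    have : 0 ≤ Real.log x ^ (1 / 6 : ℝ) := by positivity
    linarith
  set α := saddlePoint x y with hαdef
  have hα0 : 0 < α := by linarith
  set ζt := smoothZeta α y / Real.sqrt (saddlePhi₂ α y) with hζt
  have hζt0 : 0 < ζt := div_pos (smoothZeta_pos hα0) (Real.sqrt_pos.mpr (saddlePhi₂_pos hy2 hα0))
  set 𝓟 := x ^ α * ζt with h𝓟def
  have h𝓟0 : 0 < 𝓟 := by positivity
  set S := Nat.smoothNumbersUpTo ⌊x⌋₊ (y + 1) with hS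
  have hΨle : (S.card : ℝ) ≤ C₂ * 𝓟 := by
    have h1 := hM x y hx₀M hy4 hy6' x hx1.le le_rfl
    rw [← hαdef, ← hS] at h1
    calc (S.card : ℝ) ≤ C₂0 * (x ^ α * smoothZeta α y / Real.sqrt (saddlePhi₂ α y)) := h1
      _ = C₂0 * 𝓟 := by rw [h𝓟def, hζt]; ring
      _ ≤ C₂ * 𝓟 := mul_le_mul_of_nonneg_right hC₂ge h𝓟0.le
  -- `x ≤ x^{1/40000} C₂ 𝓟` and `𝓟 ≥ x^{24/25}`
  have hxP : x ≤ x ^ ((1 : ℝ) / 40000) * (C₂ * 𝓟) := by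
    calc x = x ^ ((1 : ℝ) / 40000) * x ^ ((39999 : ℝ) / 40000) := by rw [← Real.rpow_add hx0]; norm_num
      _ ≤ x ^ ((1 : ℝ) / 40000) * (C₂ * 𝓟) :=
          mul_le_mul_of_nonneg_left (hΨ.trans hΨle) (by positivity)
  have hC₂x : C₂ ≤ x ^ ((1599 : ℝ) / 40000) := by
    have h2 : (1599 / 40000) * L₀ + 1 ≤ x ^ ((1599 : ℝ) / 40000) := by
      rw [Real.rpow_def_of_pos hx0, ← hL₀]
      have := Real.add_one_le_exp (1599 / 40000 * L₀)
      rw [show Real.log x * (1599 / 40000) = 1599 / 40000 * L₀ by rw [hL₀]; ring]; linarith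
    nlinarith
  have h𝓟24 : x ^ ((24 : ℝ) / 25) ≤ 𝓟 := by
    have h1 : x ^ ((24 : ℝ) / 25) * C₂ ≤ C₂ * 𝓟 := by
      calc x ^ ((24 : ℝ) / 25) * C₂ ≤ x ^ ((24 : ℝ) / 25) * x ^ ((1599 : ℝ) / 40000) :=
            mul_le_mul_of_nonneg_left hC₂x (by positivity)
        _ = x ^ ((39999 : ℝ) / 40000) := by rw [← Real.rpow_add hx0]; norm_num
        _ ≤ C₂ * 𝓟 := hΨ.trans hΨle
    nlinarith
  have hfact1 : L₀ ^ (2 : ℕ) ≤ x ^ ((1 : ℝ) / 20000) :=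
    logpow_le_rpow (n := 2) (by norm_num) hx1 (by norm_num; linarith)
  have hLx : L₀ * x ^ (-((1 : ℝ) / 20000)) ≤ 1 := by
    rw [Real.rpow_neg hx0.le, ← div_eq_mul_inv, div_le_one (by positivity)]
    nlinarith
  ------------------------------------------------------------------
  -- ### the values `F k`, the bound `B = C₂ 𝓟`
  set F : ℕ → ℝ := fun k => ‖∑ n ∈ S, a n * (𝐞 ((n : ℝ) * ((k : ℝ) / N₀)) : ℂ)‖ with hF
  set B : ℝ := C₂ * 𝓟 with hB
  have hB0 : 0 < B := by positivity
  have hF0 : ∀ k, 0 ≤ F k := fun k => norm_nonneg _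
  have hFS : ∀ k, F k ≤ S.card := by
    intro k
    calc F k ≤ ∑ n ∈ S, ‖a n * (𝐞 ((n : ℝ) * ((k : ℝ) / N₀)) : ℂ)‖ := norm_sum_le _ _
      _ ≤ ∑ n ∈ S, (1 : ℝ) := Finset.sum_le_sum fun n _ => by
          rw [norm_mul, Circle.norm_coe, mul_one]; exact ha n
      _ = S.card := by simp
  have hFB : ∀ k, F k ≤ B := fun k => (hFS k).trans hΨle
  ------------------------------------------------------------------
  -- ### the number of levels `J`: `2^J ≤ t < 2^{J+1}`, `t = C₂ x^{1/20000}/L₀`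
  set t : ℝ := C₂ * x ^ ((1 : ℝ) / 20000) / L₀ with ht
  have ht2 : 2 ≤ t := by
    rw [ht, le_div_iff₀ hL0]
    have : 2 * L₀ ≤ x ^ ((1 : ℝ) / 20000) := le_trans (by nlinarith) hfact1
    nlinarith
  have ht0 : 0 < t := by linarith
  set J : ℕ := Nat.log 2 ⌊t⌋₊ with hJ
  have htfloor : 2 ≤ ⌊t⌋₊ := Nat.le_floor (by exact_mod_cast ht2)
  have h2J : (2 : ℝ) ^ J ≤ t := by
    have h1 : 2 ^ J ≤ ⌊t⌋₊ := Nat.pow_log_le_self 2 (by omega)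
    calc (2 : ℝ) ^ J = ((2 ^ J : ℕ) : ℝ) := by push_cast; ring
      _ ≤ (⌊t⌋₊ : ℝ) := by exact_mod_cast h1
      _ ≤ t := Nat.floor_le ht0.le
  have htJ : t < 2 ^ (J + 1) := by
    have h1 : ⌊t⌋₊ < 2 ^ (J + 1) := Nat.lt_pow_succ_log_self (by norm_num) _
    have h2 : (⌊t⌋₊ : ℝ) + 1 ≤ ((2 ^ (J + 1) : ℕ) : ℝ) := by exact_mod_cast h1
    push_cast at h2
    linarith [Nat.lt_floor_add_one t]
  -- the levels `δ_j = C₂/2^{j+1}` are admissible for `j < J`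
  have hδlo : ∀ j : ℕ, j < J → L₀ * x ^ (-((1 : ℝ) / 20000)) ≤ C₂ / 2 ^ (j + 1) := by
    intro j hj
    have h1 : (2 : ℝ) ^ (j + 1) ≤ 2 ^ J := pow_le_pow_right₀ (by norm_num) hj
    have h2 : C₂ / t ≤ C₂ / 2 ^ (j + 1) :=
      div_le_div_of_nonneg_left hC₂0'.le (by positivity) (h1.trans h2J)
    refine le_trans (le_of_eq ?_) h2
    rw [ht, Real.rpow_neg hx0.le]; field_simp
  have htail : B / 2 ^ J ≤ 2 * L₀ * x ^ (-((1 : ℝ) / 20000)) * 𝓟 := by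
    -- `1/2^J = 2/2^{J+1} < 2/t`
    have h1 : B / 2 ^ J = 2 * B / 2 ^ (J + 1) := by rw [pow_succ]; field_simp
    rw [h1, div_le_iff₀ (by positivity)]
    have h2 : 2 * B = (2 * L₀ * x ^ (-((1 : ℝ) / 20000)) * 𝓟) * t := by
      rw [hB, ht, Real.rpow_neg hx0.le]; field_simp
    rw [h2]
    exact mul_le_mul_of_nonneg_left htJ.le (by positivity)
  ------------------------------------------------------------------
  -- ### dyadic decomposition
  have hdec := sum_rpow_le_levels (Finset.range N₀) F (B := B) (p := (5 : ℝ) / 2) (fun k _ => hF0 k)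
    (fun k _ => hFB k) (by norm_num) J
  -- ### the level counts
  have hsep : ∀ i ∈ Finset.range N₀, ∀ j ∈ Finset.range N₀, i ≠ j → ∀ k : ℤ,
      1 / x ≤ |(j : ℝ) / N₀ - (i : ℝ) / N₀ - k| := by
    intro i hi j hj hij k
    rw [Finset.mem_range] at hi hj
    have hm : ((j : ℤ) - i - k * N₀ : ℤ) ≠ 0 := by
      intro h
      have hdvd : (N₀ : ℤ) ∣ (j : ℤ) - i := ⟨k, by linarith⟩
      have hlt : |(j : ℤ) - i| < N₀ := by rw [abs_lt]; constructor <;> omega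
      have := Int.eq_zero_of_abs_lt_dvd hdvd hlt
      omega
    have h1 : (1 : ℝ) ≤ |(((j : ℤ) - i - k * N₀ : ℤ) : ℝ)| := by exact_mod_cast Int.one_le_abs hm
    have heq : (j : ℝ) / N₀ - (i : ℝ) / N₀ - k = (((j : ℤ) - i - k * N₀ : ℤ) : ℝ) / N₀ := by
      push_cast; field_simp
    rw [heq, abs_div, abs_of_pos hN₀r]
    calc 1 / x ≤ 1 / (N₀ : ℝ) := one_div_le_one_div_of_le hN₀r hNx
      _ ≤ _ := div_le_div_of_nonneg_right h1 hN₀r.le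
  have hcount : ∀ j : ℕ, j < J →
      (((Finset.range N₀).filter (fun k => B / 2 ^ (j + 1) < F k)).card : ℝ) ≤
        C_A * L₀ ^ (19 : ℕ) * (1 + (C₂ / 2 ^ (j + 1)) ^ (-((49 : ℝ) / 20))) := by
    intro j hj
    set T := (Finset.range N₀).filter (fun k => B / 2 ^ (j + 1) < F k) with hT
    have hsepT : ∀ i ∈ T, ∀ j' ∈ T, i ≠ j' → ∀ k : ℤ, 1 / x ≤ |(j' : ℝ) / N₀ - (i : ℝ) / N₀ - k| :=
      fun i hi j' hj' hij k => hsep i (Finset.mem_filter.mp hi).1 j' (Finset.mem_filter.mp hj').1 hij k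
    set δj : ℝ := C₂ / 2 ^ (j + 1) with hδj
    have hδj0 : 0 < δj := by positivity
    have hlevel : ∀ k ∈ T, δj * 𝓟 < F k := by
      intro k hk
      have := (Finset.mem_filter.mp hk).2
      rw [hδj]; rw [hB] at this
      calc C₂ / 2 ^ (j + 1) * 𝓟 = C₂ * 𝓟 / 2 ^ (j + 1) := by ring
        _ < F k := this
    have hpow0 : 0 ≤ δj ^ (-((49 : ℝ) / 20)) := by positivity
    rcases le_or_gt δj 1 with hδ1 | hδ1
    · have key := hA x y hx₀A hy8 hy6 hy200 hα h𝓟24 T (fun k : ℕ => (k : ℝ) / N₀) hsepT a ha δj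
        (hδlo j hj) hδ1 (fun k hk => by rw [← hαdef]; exact (hlevel k hk).le)
      rw [← hL₀] at key
      calc (T.card : ℝ) ≤ C_A * L₀ ^ (19 : ℕ) * δj ^ (-((49 : ℝ) / 20)) := key
        _ ≤ C_A * L₀ ^ (19 : ℕ) * (1 + δj ^ (-((49 : ℝ) / 20))) := by
            apply mul_le_mul_of_nonneg_left _ (by positivity); linarith
    · have key := hA x y hx₀A hy8 hy6 hy200 hα h𝓟24 T (fun k : ℕ => (k : ℝ) / N₀) hsepT a ha 1
        hLx le_rfl (fun k hk => by
          rw [← hαdef, one_mul]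
          have := hlevel k hk
          have : 𝓟 ≤ δj * 𝓟 := le_mul_of_one_le_left h𝓟0.le hδ1.le
          linarith)
      rw [← hL₀, Real.one_rpow, mul_one] at key
      calc (T.card : ℝ) ≤ C_A * L₀ ^ (19 : ℕ) := key
        _ ≤ C_A * L₀ ^ (19 : ℕ) * (1 + δj ^ (-((49 : ℝ) / 20))) := by
            apply le_mul_of_one_le_right (by positivity); linarith
  ------------------------------------------------------------------
  -- ### the level sum
  set ρ₁ : ℝ := (2 : ℝ) ^ (-((5 : ℝ) / 2)) with hρ₁
  set ρ₂ : ℝ := (2 : ℝ) ^ (-((1 : ℝ) / 20)) with hρ₂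
  have hgeom := geom_sums_aux J
  rw [← hρ₁, ← hρ₂] at hgeom
  have hBpow : B ^ ((5 : ℝ) / 2) = C₂ ^ ((5 : ℝ) / 2) * 𝓟 ^ ((5 : ℝ) / 2) := by
    rw [hB, Real.mul_rpow hC₂0'.le h𝓟0.le]
  -- `(B/2^j)^{5/2} = B^{5/2} ρ₁^j`
  have hlev1 : ∀ j : ℕ, (B / 2 ^ j) ^ ((5 : ℝ) / 2) = B ^ ((5 : ℝ) / 2) * ρ₁ ^ j := by
    intro j
    rw [Real.div_rpow hB0.le (by positivity), div_eq_mul_inv, hρ₁]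
    congr 1
    rw [← Real.rpow_natCast, ← Real.rpow_natCast, ← Real.rpow_mul (by norm_num),
      ← Real.rpow_neg (by positivity), ← Real.rpow_mul (by norm_num)]
    congr 1; ring
  -- `(C₂/2^{j+1})^{-49/20} = C₂^{-49/20} 2^{49/20} (2^{49/20})^j`
  have hlev2 : ∀ j : ℕ, (C₂ / 2 ^ (j + 1)) ^ (-((49 : ℝ) / 20)) =
      C₂ ^ (-((49 : ℝ) / 20)) * (2 : ℝ) ^ ((49 : ℝ) / 20) * ((2 : ℝ) ^ ((49 : ℝ) / 20)) ^ j := by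
    intro j
    rw [Real.div_rpow hC₂0'.le (by positivity), div_eq_mul_inv, ← Real.rpow_neg (by positivity),
      neg_neg, mul_assoc]
    congr 1
    rw [← Real.rpow_natCast (2 : ℝ) (j + 1), ← Real.rpow_mul (by norm_num), ← Real.rpow_natCast,
      ← Real.rpow_mul (by norm_num), ← Real.rpow_add (by norm_num)]
    congr 1; push_cast; ring
  have hρ₁ρ₂ : ∀ j : ℕ, ρ₁ ^ j * ((2 : ℝ) ^ ((49 : ℝ) / 20)) ^ j = ρ₂ ^ j := by
    intro j
    rw [← mul_pow, hρ₁, hρ₂, ← Real.rpow_add (by norm_num)]; norm_num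
  have h249 : (2 : ℝ) ^ ((49 : ℝ) / 20) ≤ 8 := by
    calc (2 : ℝ) ^ ((49 : ℝ) / 20) ≤ 2 ^ (3 : ℝ) := Real.rpow_le_rpow_of_exponent_le (by norm_num) (by norm_num)
      _ = 8 := by norm_num
  have hC49 : C₂ ^ (-((49 : ℝ) / 20)) ≤ 1 := Real.rpow_le_one_of_one_le_of_nonpos hC₂1 (by norm_num)
  have hlevelsum : ∑ j ∈ Finset.range J, (B / 2 ^ j) ^ ((5 : ℝ) / 2) *
      (((Finset.range N₀).filter (fun k => B / 2 ^ (j + 1) < F k)).card : ℝ) ≤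
      322 * C_A * C₂ ^ ((5 : ℝ) / 2) * L₀ ^ (19 : ℕ) * 𝓟 ^ ((5 : ℝ) / 2) := by
    calc ∑ j ∈ Finset.range J, (B / 2 ^ j) ^ ((5 : ℝ) / 2) *
          (((Finset.range N₀).filter (fun k => B / 2 ^ (j + 1) < F k)).card : ℝ)
        ≤ ∑ j ∈ Finset.range J, (B ^ ((5 : ℝ) / 2) * ρ₁ ^ j) *
            (C_A * L₀ ^ (19 : ℕ) * (1 + (C₂ / 2 ^ (j + 1)) ^ (-((49 : ℝ) / 20)))) := by
          refine Finset.sum_le_sum fun j hj => ?_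
          rw [hlev1]
          exact mul_le_mul_of_nonneg_left (hcount j (Finset.mem_range.mp hj)) (by positivity)
      _ = C_A * L₀ ^ (19 : ℕ) * B ^ ((5 : ℝ) / 2) *
            (∑ j ∈ Finset.range J, ρ₁ ^ j +
              C₂ ^ (-((49 : ℝ) / 20)) * (2 : ℝ) ^ ((49 : ℝ) / 20) * ∑ j ∈ Finset.range J, ρ₂ ^ j) := by
          rw [Finset.mul_sum, mul_add, Finset.mul_sum, Finset.mul_sum, ← Finset.sum_add_distrib]
          refine Finset.sum_congr rfl fun j _ => ?_
          rw [hlev2, ← hρ₁ρ₂]; ring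
      _ ≤ C_A * L₀ ^ (19 : ℕ) * B ^ ((5 : ℝ) / 2) * (2 + 1 * 8 * 40) := by
          apply mul_le_mul_of_nonneg_left _ (by positivity)
          apply add_le_add hgeom.1
          apply mul_le_mul (mul_le_mul hC49 h249 (by positivity) (by norm_num)) hgeom.2
            (Finset.sum_nonneg fun _ _ => by positivity) (by norm_num)
      _ = 322 * C_A * C₂ ^ ((5 : ℝ) / 2) * L₀ ^ (19 : ℕ) * 𝓟 ^ ((5 : ℝ) / 2) := by rw [hBpow]; ring
  ------------------------------------------------------------------
  -- ### the tail
  have hL2sum : ∑ k ∈ Finset.range N₀, F k ^ 2 ≤ 4 * x * S.card := by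
    have hSmem : ∀ n ∈ S, 1 ≤ n ∧ n ≤ ⌊x⌋₊ := by
      intro n hn
      rw [hS, Nat.mem_smoothNumbersUpTo] at hn
      exact ⟨Nat.pos_of_ne_zero (Nat.mem_smoothNumbers.mp hn.2).1, hn.1⟩
    exact sum_norm_sq_points_le hN₀ hNx S hSmem a ha
  have htailsum : ∑ k ∈ (Finset.range N₀).filter (fun k => F k ≤ B / 2 ^ J), F k ^ ((5 : ℝ) / 2) ≤
      6 * C₂ ^ 2 * L₀ ^ (19 : ℕ) * 𝓟 ^ ((5 : ℝ) / 2) := by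
    set V : ℝ := 2 * L₀ * x ^ (-((1 : ℝ) / 20000)) * 𝓟 with hV
    have hV0 : 0 ≤ V := by positivity
    have h1 : ∑ k ∈ (Finset.range N₀).filter (fun k => F k ≤ B / 2 ^ J), F k ^ ((5 : ℝ) / 2) ≤
        V ^ ((1 : ℝ) / 2) * ∑ k ∈ Finset.range N₀, F k ^ 2 := by
      rw [Finset.mul_sum]
      calc ∑ k ∈ (Finset.range N₀).filter (fun k => F k ≤ B / 2 ^ J), F k ^ ((5 : ℝ) / 2)
          ≤ ∑ k ∈ (Finset.range N₀).filter (fun k => F k ≤ B / 2 ^ J), V ^ ((1 : ℝ) / 2) * F k ^ 2 := by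
            refine Finset.sum_le_sum fun k hk => ?_
            have hkV : F k ≤ V := ((Finset.mem_filter.mp hk).2).trans htail
            have e : F k ^ ((5 : ℝ) / 2) = F k ^ ((1 : ℝ) / 2) * F k ^ 2 := by
              rw [show (F k ^ 2 : ℝ) = F k ^ (2 : ℝ) by norm_cast, ← Real.rpow_add' (hF0 k) (by norm_num)]
              norm_num
            rw [e]
            exact mul_le_mul_of_nonneg_right (Real.rpow_le_rpow (hF0 k) hkV (by norm_num)) (by positivity)
        _ ≤ ∑ k ∈ Finset.range N₀, V ^ ((1 : ℝ) / 2) * F k ^ 2 :=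
            Finset.sum_le_sum_of_subset_of_nonneg (Finset.filter_subset _ _) (fun k _ _ => by positivity)
    refine h1.trans ?_
    -- `V^{1/2} · 4 x #S ≤ √2 L₀^{1/2} x^{-1/40000} 𝓟^{1/2} · 4 · x^{1/40000} C₂ 𝓟 · C₂ 𝓟`
    have hVhalf : V ^ ((1 : ℝ) / 2) = (2 * L₀) ^ ((1 : ℝ) / 2) * x ^ (-((1 : ℝ) / 40000)) * 𝓟 ^ ((1 : ℝ) / 2) := by
      rw [hV, Real.mul_rpow (by positivity) h𝓟0.le, Real.mul_rpow (by positivity) (by positivity),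
        ← Real.rpow_mul hx0.le]
      norm_num
    have h2L : (2 * L₀) ^ ((1 : ℝ) / 2) ≤ 2 * L₀ := by
      have h2L1 : (1 : ℝ) ≤ 2 * L₀ := by linarith
      calc (2 * L₀) ^ ((1 : ℝ) / 2) ≤ (2 * L₀) ^ (1 : ℝ) := Real.rpow_le_rpow_of_exponent_le h2L1 (by norm_num)
        _ = 2 * L₀ := Real.rpow_one _
    have hxS : 4 * x * (S.card : ℝ) ≤ 4 * (x ^ ((1 : ℝ) / 40000) * (C₂ * 𝓟)) * (C₂ * 𝓟) :=
      mul_le_mul (mul_le_mul_of_nonneg_left hxP (by norm_num)) hΨle (by positivity) (by positivity)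
    have hxx : x ^ (-((1 : ℝ) / 40000)) * x ^ ((1 : ℝ) / 40000) = 1 := by
      rw [← Real.rpow_add hx0]; norm_num
    have h𝓟pow : 𝓟 ^ ((1 : ℝ) / 2) * 𝓟 * 𝓟 = 𝓟 ^ ((5 : ℝ) / 2) := by
      rw [show 𝓟 ^ ((1 : ℝ) / 2) * 𝓟 * 𝓟 = 𝓟 ^ ((1 : ℝ) / 2) * 𝓟 ^ (2 : ℝ) by rw [Real.rpow_two]; ring,
        ← Real.rpow_add h𝓟0]; norm_num
    have hL19 : L₀ ≤ L₀ ^ (19 : ℕ) := by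
      calc L₀ = L₀ ^ 1 := (pow_one _).symm
        _ ≤ L₀ ^ (19 : ℕ) := pow_le_pow_right₀ hL1 (by norm_num)
    calc V ^ ((1 : ℝ) / 2) * ∑ k ∈ Finset.range N₀, F k ^ 2
        ≤ ((2 * L₀) * x ^ (-((1 : ℝ) / 40000)) * 𝓟 ^ ((1 : ℝ) / 2)) *
            (4 * (x ^ ((1 : ℝ) / 40000) * (C₂ * 𝓟)) * (C₂ * 𝓟)) := by
          rw [hVhalf]
          apply mul_le_mul _ (hL2sum.trans hxS) (Finset.sum_nonneg fun _ _ => by positivity) (by positivity)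
          exact mul_le_mul_of_nonneg_right (mul_le_mul_of_nonneg_right h2L (by positivity)) (by positivity)
      _ = 8 * C₂ ^ 2 * L₀ * (x ^ (-((1 : ℝ) / 40000)) * x ^ ((1 : ℝ) / 40000)) * (𝓟 ^ ((1 : ℝ) / 2) * 𝓟 * 𝓟) := by
          ring
      _ = 8 * C₂ ^ 2 * L₀ * 𝓟 ^ ((5 : ℝ) / 2) := by rw [hxx, h𝓟pow]; ring
      _ ≤ 6 * C₂ ^ 2 * L₀ ^ (19 : ℕ) * 𝓟 ^ ((5 : ℝ) / 2) := by
          -- `8 L₀ ≤ 6 L₀^{19}` since `L₀^{18} ≥ 2`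
          have : 8 * L₀ ≤ 6 * L₀ ^ (19 : ℕ) := by
            have h18 : (2 : ℝ) ≤ L₀ ^ (18 : ℕ) := by
              calc (2 : ℝ) ≤ L₀ := hL2
                _ = L₀ ^ 1 := (pow_one _).symm
                _ ≤ L₀ ^ (18 : ℕ) := pow_le_pow_right₀ hL1 (by norm_num)
            calc 8 * L₀ ≤ 6 * (L₀ ^ (18 : ℕ) * L₀) := by nlinarith
              _ = 6 * L₀ ^ (19 : ℕ) := by ring
          have h0 : 0 ≤ C₂ ^ 2 * 𝓟 ^ ((5 : ℝ) / 2) := by positivity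
          nlinarith
  ------------------------------------------------------------------
  -- ### combine
  show ∑ k ∈ Finset.range N₀, F k ^ ((5 : ℝ) / 2) ≤ _
  calc ∑ k ∈ Finset.range N₀, F k ^ ((5 : ℝ) / 2)
      ≤ _ := hdec
    _ ≤ 322 * C_A * C₂ ^ ((5 : ℝ) / 2) * L₀ ^ (19 : ℕ) * 𝓟 ^ ((5 : ℝ) / 2) +
          6 * C₂ ^ 2 * L₀ ^ (19 : ℕ) * 𝓟 ^ ((5 : ℝ) / 2) := add_le_add hlevelsum htailsum
    _ = (322 * C_A * C₂ ^ ((5 : ℝ) / 2) + 6 * C₂ ^ 2) * L₀ ^ (19 : ℕ) * 𝓟 ^ ((5 : ℝ) / 2) := by ring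

end Literature.NumberTheory.Sieve

end
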